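import Literature.AlgebraicTopology.CharacteristicClasses.ProjectiveCompletion
import Literature.AlgebraicTopology.CharacteristicClasses.ProjectivizationHomotopy
import Literature.AlgebraicTopology.CharacteristicClasses.FibrewiseContinuity
import HarnessLib

/-!
# Functoriality of the projective completion: bundle maps `ξ₁ → ξ₂` induce `P(ξ₁ ⊕ ℂ) → P(ξ₂ ⊕ ℂ)`

D. Husemoller, *Fibre Bundles* (3rd ed. 1994), Ch. 3 §2–§3 (morphisms of vector bundles;
induced bundles, Prop. 3.2) and Ch. 17 §2 (functoriality of `P(η)`, used for the naturality
`f^* c(ξ) = c(f^* ξ)` in Prop. 3.3): a map of vector bundles `(Ψ, g) : ξ₁ → ξ₂`, fibrewise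
INJECTIVE linear (`Ψ ⟨b, v⟩ = ⟨g b, φ_b v⟩`), induces the fibrewise projectivisation
`PΨ : P(ξ₁ ⊕ ℂ) → P(ξ₂ ⊕ ℂ)`, `⟨b, ℓ⟩ ↦ ⟨g b, ℙ(φ_b ⊕ 1) ℓ⟩` (`complMap`).

* **`continuous_complMap`** — `PΨ` is continuous as soon as `Ψ` is: in the local product
  structures its expression is `(b, ℓ) ↦ ℙ(A_b ⊕ 1) ℓ` with `A_b = ẽ₂ ∘ φ_b ∘ ẽ₁⁻¹` the local
  expression of `Ψ`, jointly continuous in `(b, ℓ)` because `(b, x) ↦ A_b x` is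
  (`ProjectivizationHomotopy.continuous_projectivizationMap₂`; criterion
  `FibrewiseContinuity.continuousAt_totalSpace_map`);
* `complMap` commutes with the projections, the zero sections, the fibre inclusions
  (`complMap_complZero`, `complMap_comp_complFibreIncl`) and — for line bundles and fibrewise
  ISOMORPHISMS — with the sections at infinity (`complMap_complInf`);
* the two instances used for Chern classes: the pull-back `f^* ξ → ξ` (`complPullbackMap`,
  Mathlib's `Pullback.lift`) and a fibrewise isomorphism over `B` (`complIsoMap`).

Everything is proved; no named facts.

## References

* D. Husemoller, *Fibre Bundles*, GTM 20, Springer 1994, Ch. 3 §2–§3, Ch. 17 §2 Prop. 3.3.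
  [HusemollerFibreBundles1994]
-/

noncomputable section

open Function Set Filter Bundle Topology Trivialization
open scoped LinearAlgebra.Projectivization

universe u

namespace Literature.AlgebraicTopology.CharacteristicClasses

section Canonical

variable {B : Type u} [TopologicalSpace B] {F : Type u} [NormedAddCommGroup F] [NormedSpace ℂ F] [FiniteDimensional ℂ F]
  {E : B → Type u} [∀ b, AddCommGroup (E b)] [∀ b, Module ℂ (E b)]
  [TopologicalSpace (TotalSpace F E)] [∀ b, TopologicalSpace (E b)] [FiberBundle F E] [VectorBundle ℂ F E]

set_option maxHeartbeats 800000 in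
/-- The canonical trivialisation of `P(ξ ⊕ ℂ)` at `b₀` on the fibre coordinate:
`⟨b, ℓ⟩ ↦ ℙ(ẽ_b × 𝟙) ℓ` with `ẽ` the fibre isomorphisms of `(trivializationAt b₀) × 𝟙`. [folklore] -/
theorem trivializationAt_compl_apply_snd (b₀ : B) (p : ProjCompl F E) :
    (trivializationAt (ℙ ℂ (F × ℂ)) (fun b ↦ ℙ ℂ (ComplFib E b)) b₀ p).2 =
      Projectivization.map ((linEquivAt ℂ (F × ℂ) (ComplFib E) (prodTriv (trivializationAt F E b₀)) p.proj :
          ComplFib E p.proj →L[ℂ] F × ℂ) : ComplFib E p.proj →ₗ[ℂ] F × ℂ)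
        (linEquivAt ℂ (F × ℂ) (ComplFib E) (prodTriv (trivializationAt F E b₀)) p.proj).injective p.2 := rfl

set_option maxHeartbeats 800000 in
/-- Its first coordinate is the projection. [folklore] -/
theorem trivializationAt_compl_apply_fst (b₀ : B) (p : ProjCompl F E) :
    (trivializationAt (ℙ ℂ (F × ℂ)) (fun b ↦ ℙ ℂ (ComplFib E b)) b₀ p).1 = p.proj := rfl

set_option maxHeartbeats 800000 in
/-- The local inverse of the canonical trivialisation of `P(ξ ⊕ ℂ)` at `b₀`:
`(b, ℓ) ↦ ⟨b, ℙ((ẽ_b × 𝟙)⁻¹) ℓ⟩`. [folklore] -/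
theorem trivializationAt_compl_symm_apply (b₀ : B) (q : B × ℙ ℂ (F × ℂ)) :
    (trivializationAt (ℙ ℂ (F × ℂ)) (fun b ↦ ℙ ℂ (ComplFib E b)) b₀).toPartialEquiv.symm q =
      ⟨q.1, Projectivization.map (((linEquivAt ℂ (F × ℂ) (ComplFib E) (prodTriv (trivializationAt F E b₀)) q.1).symm :
          F × ℂ →L[ℂ] ComplFib E q.1) : F × ℂ →ₗ[ℂ] ComplFib E q.1)
        (linEquivAt ℂ (F × ℂ) (ComplFib E) (prodTriv (trivializationAt F E b₀)) q.1).symm.injective q.2⟩ := rfl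

end Canonical

section Map

variable {B₁ B₂ : Type u} [TopologicalSpace B₁] [TopologicalSpace B₂]
  (F₁ : Type u) [NormedAddCommGroup F₁] [NormedSpace ℂ F₁] [FiniteDimensional ℂ F₁]
  (F₂ : Type u) [NormedAddCommGroup F₂] [NormedSpace ℂ F₂] [FiniteDimensional ℂ F₂]
  (E₁ : B₁ → Type u) [∀ b, AddCommGroup (E₁ b)] [∀ b, Module ℂ (E₁ b)]
  [TopologicalSpace (TotalSpace F₁ E₁)] [∀ b, TopologicalSpace (E₁ b)] [FiberBundle F₁ E₁] [VectorBundle ℂ F₁ E₁]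
  (E₂ : B₂ → Type u) [∀ b, AddCommGroup (E₂ b)] [∀ b, Module ℂ (E₂ b)]
  [TopologicalSpace (TotalSpace F₂ E₂)] [∀ b, TopologicalSpace (E₂ b)] [FiberBundle F₂ E₂] [VectorBundle ℂ F₂ E₂]

variable {F₁ F₂ E₁ E₂}
variable {g : C(B₁, B₂)} (φ : ∀ b, E₁ b →ₗ[ℂ] E₂ (g b)) (hφ : ∀ b, Injective (φ b))

/-- `[v] = [w]` for equal vectors. [folklore] -/
theorem mk_congr_vec {V : Type*} [AddCommGroup V] [Module ℂ V] {v w : V} (h : v = w) (hv : v ≠ 0) (hw : w ≠ 0) :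
    Projectivization.mk ℂ v hv = Projectivization.mk ℂ w hw := by
  subst h
  rfl

include hφ in
omit [∀ b, TopologicalSpace (E₁ b)] [∀ b, TopologicalSpace (E₂ b)] in
/-- `φ_b ⊕ 1` is injective. [folklore] -/
theorem prodMap_id_injective (b : B₁) : Injective ((φ b).prodMap (LinearMap.id : ℂ →ₗ[ℂ] ℂ)) :=
  (hφ b).prodMap injective_id

variable (F₁ F₂ E₁ E₂) in
/-- **The induced map `PΨ : P(ξ₁ ⊕ ℂ) → P(ξ₂ ⊕ ℂ)`, `⟨b, ℓ⟩ ↦ ⟨g b, ℙ(φ_b ⊕ 1) ℓ⟩`** of a fibrewise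
injective linear bundle map. [cite: HusemollerFibreBundles1994, Ch. 17 §2] -/
def complMap : ProjCompl F₁ E₁ → ProjCompl F₂ E₂ := fun p ↦
  ⟨g p.proj, Projectivization.map ((φ p.proj).prodMap (LinearMap.id : ℂ →ₗ[ℂ] ℂ)) (prodMap_id_injective φ hφ p.proj) p.2⟩

omit [FiniteDimensional ℂ F₁] [FiniteDimensional ℂ F₂] [TopologicalSpace (TotalSpace F₁ E₁)] [FiberBundle F₁ E₁]
  [VectorBundle ℂ F₁ E₁] [TopologicalSpace (TotalSpace F₂ E₂)] [FiberBundle F₂ E₂] [VectorBundle ℂ F₂ E₂]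
  [∀ b, TopologicalSpace (E₁ b)] [∀ b, TopologicalSpace (E₂ b)] in
/-- `PΨ` covers `g`. [folklore] -/
@[simp]
theorem complMap_proj (p : ProjCompl F₁ E₁) : (complMap F₁ F₂ E₁ E₂ φ hφ p).proj = g p.proj := rfl

omit [FiniteDimensional ℂ F₁] [FiniteDimensional ℂ F₂] [TopologicalSpace (TotalSpace F₁ E₁)] [FiberBundle F₁ E₁]
  [VectorBundle ℂ F₁ E₁] [TopologicalSpace (TotalSpace F₂ E₂)] [FiberBundle F₂ E₂] [VectorBundle ℂ F₂ E₂]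
  [∀ b, TopologicalSpace (E₁ b)] [∀ b, TopologicalSpace (E₂ b)] in
/-- `PΨ ⟨b, [v : t]⟩ = ⟨g b, [φ_b v : t]⟩`. [folklore] -/
theorem complMap_apply_mk (b : B₁) (v : E₁ b) (t : ℂ) (h : ((v, t) : E₁ b × ℂ) ≠ 0) :
    complMap F₁ F₂ E₁ E₂ φ hφ ⟨b, Projectivization.mk ℂ (v, t) h⟩ =
      ⟨g b, Projectivization.mk ℂ (φ b v, t) (fun h0 ↦ h (prodMap_id_injective φ hφ b
        (h0.trans (map_zero ((φ b).prodMap (LinearMap.id : ℂ →ₗ[ℂ] ℂ))).symm)))⟩ := by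
  rw [complMap]
  congr 1

/-- `PΨ` maps the zero section to the zero section. [folklore] -/
theorem complMap_complZero (b : B₁) :
    complMap F₁ F₂ E₁ E₂ φ hφ (complZero F₁ E₁ b) = complZero F₂ E₂ (g b) := by
  rw [complZero_apply, zeroPt, complMap_apply_mk, complZero_apply, zeroPt]
  congr 2
  rw [map_zero]

/-- `PΨ ∘ s₀ = s₀ ∘ g`. [folklore] -/
theorem complMap_comp_complZero :
    complMap F₁ F₂ E₁ E₂ φ hφ ∘ complZero F₁ E₁ = complZero F₂ E₂ ∘ g :=
  funext fun b ↦ complMap_complZero φ hφ b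

/-! ### Continuity -/

variable (F₁ F₂ E₁ E₂) in
/-- The local expression of the bundle map in the canonical charts: `A_b x = ẽ₂ (φ_b (ẽ₁⁻¹ x))`. [folklore] -/
def localExpr (b₀ : B₁) (b : B₁) (x : F₁) : F₂ :=
  linEquivAt ℂ F₂ E₂ (trivializationAt F₂ E₂ (g b₀)) (g b)
    (φ b ((linEquivAt ℂ F₁ E₁ (trivializationAt F₁ E₁ b₀) b).symm x))

omit [FiniteDimensional ℂ F₁] [FiniteDimensional ℂ F₂] in
/-- The local expression is that of `Ψ` read in the canonical trivialisations, on the common chart domain.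
[folklore] -/
theorem localExpr_eq {b₀ b : B₁} (hb₁ : b ∈ (trivializationAt F₁ E₁ b₀).baseSet)
    (hb₂ : g b ∈ (trivializationAt F₂ E₂ (g b₀)).baseSet) (x : F₁) :
    localExpr F₁ F₂ E₁ E₂ φ b₀ b x =
      (trivializationAt F₂ E₂ (g b₀) ⟨g b, φ b ((trivializationAt F₁ E₁ b₀).symm b x)⟩).2 := by
  rw [localExpr, linEquivAt_apply _ hb₂, linEquivAt_symm_apply _ hb₁]

variable (hΨ : Continuous fun q : TotalSpace F₁ E₁ ↦ (⟨g q.proj, φ q.proj q.2⟩ : TotalSpace F₂ E₂))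
include hΨ

omit [FiniteDimensional ℂ F₁] [FiniteDimensional ℂ F₂] in
/-- **The local expression `(b, x) ↦ A_b x` is jointly continuous on the common chart domain.** [folklore] -/
theorem continuousOn_localExpr (b₀ : B₁) :
    ContinuousOn (fun q : B₁ × F₁ ↦ localExpr F₁ F₂ E₁ E₂ φ b₀ q.1 q.2)
      (((trivializationAt F₁ E₁ b₀).baseSet ∩ g ⁻¹' (trivializationAt F₂ E₂ (g b₀)).baseSet) ×ˢ univ) := by
  set e₁ := trivializationAt F₁ E₁ b₀ with he₁
  set e₂ := trivializationAt F₂ E₂ (g b₀) with he₂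
  have hsub : (e₁.baseSet ∩ g ⁻¹' e₂.baseSet) ×ˢ (univ : Set F₁) ⊆ e₁.target := by
    intro q hq
    rw [e₁.target_eq]
    exact ⟨hq.1.1, mem_univ _⟩
  have hcont : ContinuousOn (fun q : B₁ × F₁ ↦
      (e₂ ((fun q : TotalSpace F₁ E₁ ↦ (⟨g q.proj, φ q.proj q.2⟩ : TotalSpace F₂ E₂)) (e₁.toOpenPartialHomeomorph.symm q))).2)
      ((e₁.baseSet ∩ g ⁻¹' e₂.baseSet) ×ˢ univ) := by
    refine (continuous_snd.comp_continuousOn e₂.continuousOn_toFun).comp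
      (hΨ.comp_continuousOn (e₁.toOpenPartialHomeomorph.continuousOn_symm.mono hsub)) fun q hq ↦ ?_
    rw [e₂.mem_source]
    change g (e₁.toOpenPartialHomeomorph.symm q).proj ∈ e₂.baseSet
    rw [e₁.proj_symm_apply (hsub hq)]
    exact hq.1.2
  refine hcont.congr fun q hq ↦ ?_
  obtain ⟨⟨hq₁, hq₂⟩, -⟩ := hq
  change localExpr F₁ F₂ E₁ E₂ φ b₀ q.1 q.2 = (e₂ ⟨g (e₁.toOpenPartialHomeomorph.symm q).proj, φ _ (e₁.toOpenPartialHomeomorph.symm q).2⟩).2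
  rw [localExpr_eq φ hq₁ hq₂]
  have hsymm : e₁.toOpenPartialHomeomorph.symm q = ⟨q.1, e₁.symm q.1 q.2⟩ := by
    have := e₁.mk_symm (by exact hq₁ : q.1 ∈ e₁.baseSet) q.2
    rw [← this]
  rw [hsymm]

/-- **`PΨ` is continuous** when `Ψ` is (Husemoller Ch. 3 §2: continuity is read in charts, where
`PΨ` is `(b, ℓ) ↦ ℙ(A_b ⊕ 1) ℓ`). [cite: HusemollerFibreBundles1994, Ch. 17 §2] -/
theorem continuous_complMap : Continuous (complMap F₁ F₂ E₁ E₂ φ hφ) := by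
  refine continuous_totalSpace_map (F₁ := ℙ ℂ (F₁ × ℂ)) (F₂ := ℙ ℂ (F₂ × ℂ))
    (E₁ := fun b ↦ ℙ ℂ (ComplFib E₁ b)) (E₂ := fun b ↦ ℙ ℂ (ComplFib E₂ b)) g.continuous
    (fun b ℓ ↦ Projectivization.map ((φ b).prodMap (LinearMap.id : ℂ →ₗ[ℂ] ℂ)) (prodMap_id_injective φ hφ b) ℓ)
    fun p ↦ ?_
  set b₀ := p.proj with hb₀
  -- the family of linear maps `M_b = (ẽ₂ ∘ φ_b ∘ ẽ₁⁻¹) ⊕ 1` over the common chart domain `W`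
  set W : Set B₁ := (trivializationAt F₁ E₁ b₀).baseSet ∩ g ⁻¹' (trivializationAt F₂ E₂ (g b₀)).baseSet with hW
  have hWo : IsOpen W := (trivializationAt F₁ E₁ b₀).open_baseSet.inter ((trivializationAt F₂ E₂ (g b₀)).open_baseSet.preimage g.continuous)
  have hb₀W : b₀ ∈ W := ⟨mem_baseSet_trivializationAt F₁ E₁ b₀, mem_baseSet_trivializationAt F₂ E₂ (g b₀)⟩
  obtain ⟨M, hM⟩ : ∃ M : ↥W → (F₁ × ℂ) →ₗ[ℂ] (F₂ × ℂ), ∀ (b : ↥W) (w : F₁ × ℂ),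
      M b w = (localExpr F₁ F₂ E₁ E₂ φ b₀ b w.1, w.2) :=
    ⟨fun b ↦ LinearMap.prodMap
        (((linEquivAt ℂ F₂ E₂ (trivializationAt F₂ E₂ (g b₀)) (g b) : E₂ (g b) →L[ℂ] F₂) : E₂ (g b) →ₗ[ℂ] F₂).comp
          ((φ b).comp (((linEquivAt ℂ F₁ E₁ (trivializationAt F₁ E₁ b₀) b).symm : F₁ →L[ℂ] E₁ b) : F₁ →ₗ[ℂ] E₁ b)))
        (LinearMap.id : ℂ →ₗ[ℂ] ℂ),
      fun _ _ ↦ rfl⟩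
  have hMinj : ∀ b, Injective (M b) := fun b w w' h ↦ by
    rw [hM, hM, Prod.mk.injEq] at h
    refine Prod.ext ?_ h.2
    have h1 := (linEquivAt ℂ F₂ E₂ (trivializationAt F₂ E₂ (g b₀)) (g b)).injective h.1
    exact (linEquivAt ℂ F₁ E₁ (trivializationAt F₁ E₁ b₀) b).symm.injective (hφ b h1)
  have hMc : Continuous fun q : ↥W × (F₁ × ℂ) ↦ M q.1 q.2 := by
    have h1 : Continuous fun q : ↥W × F₁ ↦ localExpr F₁ F₂ E₁ E₂ φ b₀ q.1 q.2 := by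
      have := continuousOn_localExpr φ hΨ b₀
      rw [continuousOn_iff_continuous_restrict] at this
      exact this.comp (((continuous_subtype_val.comp continuous_fst).prodMk continuous_snd).subtype_mk
        fun q ↦ ⟨q.1.2, mem_univ _⟩)
    have heqM : (fun q : ↥W × (F₁ × ℂ) ↦ M q.1 q.2) = fun q ↦ (localExpr F₁ F₂ E₁ E₂ φ b₀ q.1 q.2.1, q.2.2) :=
      funext fun q ↦ hM q.1 q.2
    rw [heqM]
    exact (h1.comp (continuous_fst.prodMk (continuous_fst.comp continuous_snd))).prodMk (continuous_snd.comp continuous_snd)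
  have hPM : Continuous fun q : ↥W × ℙ ℂ (F₁ × ℂ) ↦ Projectivization.map (M q.1) (hMinj q.1) q.2 :=
    continuous_projectivizationMap₂ M hMinj hMc
  -- the local expression of `PΨ` agrees with `ℙ(M_b)` over `W`
  have hloc : ∀ q : B₁ × ℙ ℂ (F₁ × ℂ), ∀ hq : q.1 ∈ W,
      (trivializationAt (ℙ ℂ (F₂ × ℂ)) (fun b ↦ ℙ ℂ (ComplFib E₂ b)) (g b₀)
        ⟨g ((trivializationAt (ℙ ℂ (F₁ × ℂ)) (fun b ↦ ℙ ℂ (ComplFib E₁ b)) b₀).toPartialEquiv.symm q).proj,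
          Projectivization.map ((φ _).prodMap (LinearMap.id : ℂ →ₗ[ℂ] ℂ)) (prodMap_id_injective φ hφ _)
            ((trivializationAt (ℙ ℂ (F₁ × ℂ)) (fun b ↦ ℙ ℂ (ComplFib E₁ b)) b₀).toPartialEquiv.symm q).2⟩).2 =
        Projectivization.map (M ⟨q.1, hq⟩) (hMinj ⟨q.1, hq⟩) q.2 := by
    rintro ⟨b, ℓ⟩ hq
    obtain ⟨hb₁, hb₂⟩ := hq
    rw [trivializationAt_compl_symm_apply, trivializationAt_compl_apply_snd]
    dsimp only
    induction ℓ using Projectivization.ind with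
    | h w hw =>
      simp only [Projectivization.map_mk]
      have hvec : (linEquivAt ℂ (F₂ × ℂ) (ComplFib E₂) (prodTriv (trivializationAt F₂ E₂ (g b₀))) (g b))
          (((φ b).prodMap (LinearMap.id : ℂ →ₗ[ℂ] ℂ))
            ((linEquivAt ℂ (F₁ × ℂ) (ComplFib E₁) (prodTriv (trivializationAt F₁ E₁ b₀)) b).symm w)) =
            M ⟨b, ⟨hb₁, hb₂⟩⟩ w := by
        rw [hM, linEquivAt_prodTriv_eq (trivializationAt F₁ E₁ b₀) hb₁,
          linEquivAt_prodTriv_apply (trivializationAt F₂ E₂ (g b₀)) hb₂]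
        rfl
      exact mk_congr_vec hvec _ _
  -- conclude: on `W × ℙ` the local expression is `ℙ(M_b)`, continuous
  have hOn : ContinuousOn (fun q : B₁ × ℙ ℂ (F₁ × ℂ) ↦
      (trivializationAt (ℙ ℂ (F₂ × ℂ)) (fun b ↦ ℙ ℂ (ComplFib E₂ b)) (g b₀)
        ⟨g ((trivializationAt (ℙ ℂ (F₁ × ℂ)) (fun b ↦ ℙ ℂ (ComplFib E₁ b)) b₀).toPartialEquiv.symm q).proj,
          Projectivization.map ((φ _).prodMap (LinearMap.id : ℂ →ₗ[ℂ] ℂ)) (prodMap_id_injective φ hφ _)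
            ((trivializationAt (ℙ ℂ (F₁ × ℂ)) (fun b ↦ ℙ ℂ (ComplFib E₁ b)) b₀).toPartialEquiv.symm q).2⟩).2)
      (W ×ˢ univ) := by
    rw [continuousOn_iff_continuous_restrict]
    have heq : (W ×ˢ (univ : Set (ℙ ℂ (F₁ × ℂ)))).restrict (fun q : B₁ × ℙ ℂ (F₁ × ℂ) ↦
        (trivializationAt (ℙ ℂ (F₂ × ℂ)) (fun b ↦ ℙ ℂ (ComplFib E₂ b)) (g b₀)
          ⟨g ((trivializationAt (ℙ ℂ (F₁ × ℂ)) (fun b ↦ ℙ ℂ (ComplFib E₁ b)) b₀).toPartialEquiv.symm q).proj,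
            Projectivization.map ((φ _).prodMap (LinearMap.id : ℂ →ₗ[ℂ] ℂ)) (prodMap_id_injective φ hφ _)
              ((trivializationAt (ℙ ℂ (F₁ × ℂ)) (fun b ↦ ℙ ℂ (ComplFib E₁ b)) b₀).toPartialEquiv.symm q).2⟩).2) =
        fun q ↦ Projectivization.map (M ⟨q.1.1, q.2.1⟩) (hMinj _) q.1.2 :=
      funext fun q ↦ hloc q.1 q.2.1
    rw [heq]
    exact hPM.comp (((continuous_fst.comp continuous_subtype_val).subtype_mk fun q ↦ q.2.1).prodMk
      (continuous_snd.comp continuous_subtype_val))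
  refine hOn.continuousAt ((hWo.prod isOpen_univ).mem_nhds ⟨?_, mem_univ _⟩)
  change (trivializationAt (ℙ ℂ (F₁ × ℂ)) (fun b ↦ ℙ ℂ (ComplFib E₁ b)) b₀ p).1 ∈ W
  rw [Trivialization.coe_fst _ ((trivializationAt _ _ b₀).mem_source.2 (mem_baseSet_trivializationAt _ _ b₀))]
  exact hb₀W

/-! ### Compatibility with fibres and with the sections at infinity -/

omit hΨ in
/-- **`PΨ` on the fibre over `b` is `ℙ(φ_b ⊕ 1)` followed by the fibre inclusion over `g b`.** [folklore] -/
theorem complMap_comp_complFibreIncl (b : B₁) :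
    complMap F₁ F₂ E₁ E₂ φ hφ ∘ complFibreIncl F₁ E₁ b =
      complFibreIncl F₂ E₂ (g b) ∘
        Projectivization.map ((φ b).prodMap (LinearMap.id : ℂ →ₗ[ℂ] ℂ)) (prodMap_id_injective φ hφ b) := rfl

omit hΨ in
/-- **For LINE bundles, `PΨ` maps the section at infinity to the section at infinity**
(`φ_b` is injective, so `[φ_b u : 0]` is the point at infinity of the line `ξ₂_{g b}`).
[folklore] -/
theorem complMap_complInf (hF₁ : Module.finrank ℂ F₁ = 1) (hF₂ : Module.finrank ℂ F₂ = 1) (b : B₁) :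
    complMap F₁ F₂ E₁ E₂ φ hφ (complInf F₁ E₁ hF₁ b) = complInf F₂ E₂ hF₂ (g b) := by
  have hu : φ b (fibreVec F₁ E₁ hF₁ b) ≠ 0 := fun h ↦
    fibreVec_ne_zero F₁ E₁ hF₁ b (hφ b (h.trans (map_zero _).symm))
  rw [complInf_apply, infPt, complMap_apply_mk]
  exact (complInfFun_eq F₂ E₂ hF₂ (g b) hu).symm

omit hΨ in
/-- `PΨ ∘ s_∞ = s_∞ ∘ g` for line bundles. [folklore] -/
theorem complMap_comp_complInf (hF₁ : Module.finrank ℂ F₁ = 1) (hF₂ : Module.finrank ℂ F₂ = 1) :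
    complMap F₁ F₂ E₁ E₂ φ hφ ∘ complInf F₁ E₁ hF₁ = complInf F₂ E₂ hF₂ ∘ g :=
  funext fun b ↦ complMap_complInf φ hφ hF₁ hF₂ b

/-- **`PΨ` as a continuous map.** [cite: HusemollerFibreBundles1994, Ch. 17 §2] -/
def complMapC : C(ProjCompl F₁ E₁, ProjCompl F₂ E₂) :=
  ⟨complMap F₁ F₂ E₁ E₂ φ hφ, continuous_complMap φ hφ hΨ⟩

/-- The continuous map is `PΨ`. [folklore] -/
@[simp]
theorem complMapC_apply (p : ProjCompl F₁ E₁) : complMapC φ hφ hΨ p = complMap F₁ F₂ E₁ E₂ φ hφ p := rfl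

end Map

end Literature.AlgebraicTopology.CharacteristicClasses
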